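import Literature.NumberTheory.Automorphic.SymplecticBorelModulusIndex
import Literature.NumberTheory.Automorphic.SymplecticSimilitudeDoubleCosets
import HarnessLib

/-!
# The multiplier rescaling `ρ_c : (A B; C D) ↦ (A, cB; c⁻¹C, D)` of `Sp_{2n}`, the shifted Siegel balls `N^{(m)}(ν)`, and the
# twisted modulus index `[B(𝒪) : B(𝒪) ∩ ρ_{ϖ^m}(t_aB(𝒪)t_a⁻¹)] = q^{-2⟨ρ,a⟩ - ⟨ρ, m·1⟩}` — the `Sp`-side of the modulus of
# the Borel subgroup of `GSp_{2n}` (Andrianov–Zhuravlev Ch. 3 §3; Macdonald V (2.6); Cartier §IV (4.2))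

Topic `NumberTheory/Automorphic`; namespace `Literature.NumberTheory.Automorphic.SymplecticCartan` (lane `lit-hodgefound`,
Track 2 foundations; seat `lit-hodgefound-p11`, generation 45, row g45-#5).  Two DEFINITIONS WITH BODIES (`blockRescale`,
`siegelLowerBallShift`) + theorems; no named fact, no instance, no notation.  Sequel of `SymplecticBorelUnipotentRadical` (g45-#3:
root-group coordinates `u(S(C))`, `m(1 + N_k(c))`, balls `N(ν)`, `X_k(ν)`), `SymplecticBorelModulusIndex` (g45-#4: the dévissage
and `[B(𝒪) : B(𝒪) ∩ t_μB(𝒪)t_μ⁻¹] = q^{-2⟨ρ,μ⟩}`) and `SymplecticSimilitudeDoubleCosets` (g35-#6: the similitudes `diag(u·1; 1)`,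
`diag(ϖ^m ϖ^a; ϖ^{-a}) = diag(ϖ^m·1; 1)·ι(t_a)`).  It supplies the `Sp_{2n}`-side of the modulus of the Borel subgroup of
`GSp_{2n}` (the sequel `SymplecticSimilitudeBorelModulusIndex`, g45-#6, transports it through `ι : Sp → GSp`).

## The mathematics

Conjugation by the similitude `s_c = diag(c·1; 1) ∈ GSp(J, K)` (multiplier `c`) preserves `Sp(J, K) = ker r` and induces the
automorphism **`ρ_c : (A B; C D) ↦ (A, cB; c⁻¹C, D)`** of `Sp(J, K)` (`blockRescale`; outer for `c ∉ (Kˣ)²`): it fixes the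
diagonal torus and the Levi subgroup `m(D)` and rescales the Siegel radicals, `ρ_c(u(C)) = u(c⁻¹C)`.  Conjugation by the torus
representative `diag(ϖ^m ϖ^a; ϖ^{-a}) = s_{ϖ^m} ι(t_a)` of `GSp` (Kottwitz's `ϖ^λ`, A–Z's `sd(M)`) therefore acts on `Sp` as
`ρ_{ϖ^m} ∘ Int(t_a)`, and on the integral unipotent radical `U(𝒪) = N(0) ⊔ ⨆_k X_k(0)` (g45-#3) by

  `ρ_{ϖ^m}(t_a U(𝒪) t_a⁻¹) = N^{(m)}(a) ⊔ ⨆_k X_k(a)`,   `N^{(m)}(ν) = {u(C) : v(C_{ij}) ≤ exp(ν_i + ν_j + m)}`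

(`siegelLowerBallShift`; `map_blockRescale_conjAct_unipotentInt_eq`).  The SHIFT `m` is forced: for `m` odd the radii
`ν_i + ν_j + m` are not of the form `ν'_i + ν'_j` (e.g. `GL₂ = GSp₂`, `diag(ϖ, 1)`: index `q`, while `Sp₂`-conjugates only give
`q^{2k}`).  The shifted balls have the same structure as `N(ν)`: `X_k(ν)` normalises `N^{(m)}(ν)` (the radii
`(ν_i - ν_l) + (ν_l + ν_{l'} + m) + (ν_j - ν_{l'})` add up), `(⨆_j X_j) ∩ N^{(m)} = 1`, `t_μ N^{(m)}(ν) t_μ⁻¹ = N^{(m)}(ν + μ)`,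
`[N^{(m')}(ν') : N^{(m)}(ν)] = ∏_{i≤j} q^{((ν'_i+ν'_j+m') - (ν_i+ν_j+m))⁺}`.  Hence, by the dévissage of g45-#4 with the shifted
Siegel step and the twisted torus removal `B(𝒪) ⊆ U(𝒪)·ρ(t_aB(𝒪)t_a⁻¹)`, `U(𝒪) ∩ ρ(t_aB(𝒪)t_a⁻¹) = U(𝒪) ∩ ρ(t_aU(𝒪)t_a⁻¹)`:
for `a ∈ ℤⁿ` monotone with `a_i + a_j + m ≤ 0` (`i ≤ j`; antidominance of `(m, a)` for the Borel of `GSp`)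

  **`[B(𝒪) : B(𝒪) ∩ ρ_{ϖ^m}(t_aB(𝒪)t_a⁻¹)] = ∏_{i<j} q^{a_j - a_i} · ∏_{i≤j} q^{-a_i-a_j-m} = q^{-2⟨ρ,a⟩ - ⟨ρ, m·1⟩}`**

(`⟨ρ, m·1⟩ = m·n(n+1)/2 = Σ_{i≤j} m`), the value of the modulus of `GSp_{2n}` at `diag(ϖ^m ϖ^a; ϖ^{-a})` (Macdonald V (2.6):
`δ(t) = ∏_{α>0} |α(t)|` over the roots `f_i - f_j`, `f_i + f_j + (mult.)` of `GSp`).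

## What is formalised

* §1 `ofSymplectic_injective`, `coe_coe_conj_scalarBlockGSp_mem_symplecticGroup`, **`blockRescale`** (def: `ρ_c` as a
  `MonoidHom Sp Sp`, via the `GSp` conjugation), `ofSymplectic_blockRescale` (`ι(ρ_c g) = s_c ι(g) s_c⁻¹`), `coe_blockRescale_apply`
  (+ the four block formulas, `_self`), `blockRescale_of_coe_eq_diagonal`.
* §2 `blockRescale_siegelLowerHom` (`ρ_c u(S(C)) = u(S(c⁻¹C))`), `blockRescale_leviColumnHom`, `map_blockRescale_leviColumnBall`.
* §3 **`siegelLowerBallShift`** (def), `siegelLowerBallShift_zero`, `mem_siegelLowerBallShift_iff`, `…_le_symplecticUnipotent`,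
  `…_mono`, `…_le_borelInt`, `conjAct_smul_siegelLowerBallShift`, **`map_blockRescale_siegelLowerBallShift`**
  (`ρ_{ϖ^m} N^{(k)}(ν) = N^{(k+m)}(ν)`).
* §4 `leviColumnBall_le_normalizer_siegelLowerBallShift`, `iSup_leviColumnBall_le_normalizer_siegelLowerBallShift`,
  `iSup_leviColumnBall_inf_siegelLowerBallShift_eq_bot`, **`relIndex_siegelLowerBallShift`**.
* §5 **`relIndex_unipotentBallShift_eq_pow`** (`[U(0) : N^{(m)}(a) ⊔ ⨆_k X_k(a)]`).
* §6 `borelInt_subset_unipotentInt_mul_map_blockRescale`, `unipotentInt_inf_map_blockRescale_conjAct_borelInt_eq`,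
  `map_blockRescale_conjAct_unipotentInt_eq`, **`relIndex_map_blockRescale_conjAct_borelInt_eq_pow_sum`**,
  `sum_filter_le_const_eq_symplecticRhoPairing`, `sum_sub_add_sum_neg_sub_eq`, `sum_toNat_add_sum_toNat_sub_eq`,
  **`relIndex_map_blockRescale_conjAct_borelInt_eq_pow`**.

## References
* [AndrianovZhuravlev1995] A. N. Andrianov, V. G. Zhuravlev, *Modular Forms and Hecke Operators*, Transl. Math. Monogr. 145
  (1995), Ch. 1 §3 Prop. 3.7; Ch. 3 §3 (3.1), Lemma 3.4, Lemma 3.6, §3.3 Thm. 3.30.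
* [Kottwitz1992] R. E. Kottwitz, *Points on some Shimura varieties over finite fields*, J. AMS 5 (1992), §5 p. 389, §7 p. 393.
* [Macdonald1995] I. G. Macdonald, *Symmetric Functions and Hall Polynomials*, 2nd ed. (1995), Ch. V (2.6)–(2.9).
* [CartierCorvallis1979] P. Cartier, *Representations of 𝔭-adic groups: a survey*, PSPM 33.1 (1979), §I.3, §IV (4.2).
* [BruhatTits1972] F. Bruhat, J. Tits, *Groupes réductifs sur un corps local I*, Publ. Math. IHÉS 41 (1972), (4.4.3), §6.1.
* [Laumon1995] G. Laumon, *Cohomology of Drinfeld Modular Varieties I*, CUP (1996), (4.1.4).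
-/

noncomputable section

open scoped Valued WithZero Pointwise MatrixGroups
open Matrix MulAction ConjAct

namespace Literature.NumberTheory.Automorphic.SymplecticCartan

open Literature.NumberTheory.Automorphic.CartanUnique Literature.NumberTheory.Automorphic.HermitianLattice

variable {K : Type*} [Field K]

/-! ## §1 The multiplier rescaling `ρ_c ∈ Aut Sp(J, K)`: conjugation by the similitude `diag(c·1; 1)` -/

section Rescale

variable {l : Type*} [Fintype l] [DecidableEq l]

/-- `Sp(J, K) → GSp(J, K)` is injective. [cite: AndrianovZhuravlev1995, Ch. 3 §3] -/
theorem ofSymplectic_injective :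
    Function.Injective (ofSymplectic : symplecticGroup l K →* symplecticSimilitudeGroup l K) := fun A B h =>
  Subtype.ext (by
    have h' := congrArg (fun g : symplecticSimilitudeGroup l K => ((g : GL (l ⊕ l) K) : Matrix (l ⊕ l) (l ⊕ l) K)) h
    simpa only [coe_ofSymplectic] using h')

/-- `diag(a·1; b·1) J diag(a·1; b·1) = ab · J`. [folklore] -/
private theorem diagonal_elim_mul_J_mul_diagonal_elim (a b : K) :
    Matrix.diagonal (Sum.elim (fun _ : l => a) (fun _ : l => b)) * J l K *
        Matrix.diagonal (Sum.elim (fun _ : l => a) (fun _ : l => b)) = (a * b) • J l K := by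
  ext i j
  rw [Matrix.mul_diagonal, Matrix.diagonal_mul, Matrix.smul_apply, smul_eq_mul]
  rcases i with i | i <;> rcases j with j | j <;>
    simp only [Matrix.J, Matrix.fromBlocks_apply₁₁, Matrix.fromBlocks_apply₁₂, Matrix.fromBlocks_apply₂₁,
      Matrix.fromBlocks_apply₂₂, Sum.elim_inl, Sum.elim_inr, Matrix.zero_apply, Matrix.neg_apply, mul_zero, zero_mul] <;>
    ring

/-- The matrix of `diag(c·1; 1) · g · diag(c·1; 1)⁻¹` (`g ∈ Sp(J, K)`) is symplectic: conjugation by a similitude of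
multiplier `c` preserves `Sp(J, K) = ker r`. [cite: AndrianovZhuravlev1995, Ch. 3 §3 (3.1)] [cite: Kottwitz1992, §5 p. 389] -/
theorem coe_coe_conj_scalarBlockGSp_mem_symplecticGroup {c : K} (hc : c ≠ 0) (g : symplecticGroup l K) :
    (((scalarBlockGSp c hc * ofSymplectic g * (scalarBlockGSp c hc)⁻¹ : symplecticSimilitudeGroup l K) : GL (l ⊕ l) K) :
        Matrix (l ⊕ l) (l ⊕ l) K) ∈ symplecticGroup l K := by
  rw [scalarBlockGSp_inv, Subgroup.coe_mul, Subgroup.coe_mul, Units.val_mul, Units.val_mul, coe_coe_scalarBlockGSp,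
    coe_coe_scalarBlockGSp, coe_ofSymplectic, SymplecticGroup.mem_iff]
  set D := Matrix.diagonal (Sum.elim (fun _ : l => c) (fun _ : l => (1 : K))) with hD
  set D' := Matrix.diagonal (Sum.elim (fun _ : l => c⁻¹) (fun _ : l => (1 : K))) with hD'
  have hg : (g : Matrix (l ⊕ l) (l ⊕ l) K) * J l K * (g : Matrix (l ⊕ l) (l ⊕ l) K)ᵀ = J l K :=
    SymplecticGroup.mem_iff.1 g.2
  rw [Matrix.transpose_mul, Matrix.transpose_mul, hD, hD', Matrix.diagonal_transpose, Matrix.diagonal_transpose, ← hD, ← hD']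
  calc D * (g : Matrix (l ⊕ l) (l ⊕ l) K) * D' * J l K * (D' * ((g : Matrix (l ⊕ l) (l ⊕ l) K)ᵀ * D))
      = D * ((g : Matrix (l ⊕ l) (l ⊕ l) K) * (D' * J l K * D') * (g : Matrix (l ⊕ l) (l ⊕ l) K)ᵀ) * D := by
        simp only [Matrix.mul_assoc]
    _ = D * ((g : Matrix (l ⊕ l) (l ⊕ l) K) * ((c⁻¹ * 1) • J l K) * (g : Matrix (l ⊕ l) (l ⊕ l) K)ᵀ) * D := by
        rw [hD', diagonal_elim_mul_J_mul_diagonal_elim]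
    _ = c⁻¹ • (D * J l K * D) := by
        rw [mul_one, Matrix.mul_smul, Matrix.smul_mul, hg, Matrix.mul_smul, Matrix.smul_mul]
    _ = J l K := by
        rw [hD, diagonal_elim_mul_J_mul_diagonal_elim, mul_one, smul_smul, inv_mul_cancel₀ hc, one_smul]

/-- **The multiplier rescaling `ρ_c : Sp(J, K) → Sp(J, K)`** (`c ∈ Kˣ`): conjugation by the similitude `diag(c·1; 1)` of
multiplier `c`, `(A B; C D) ↦ (A, cB; c⁻¹C, D)` — an automorphism of `Sp(J, K)`, outer when `c ∉ (Kˣ)²`; it fixes the torus and the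
Levi subgroup and rescales the two Siegel radicals.  Conjugation by the similitude `diag(ϖ^m ϖ^a; ϖ^{-a}) = diag(ϖ^m·1; 1)·t_a` of
`GSp(J, K)` acts on `Sp(J, K)` as `ρ_{ϖ^m} ∘ Int(t_a)`. [cite: AndrianovZhuravlev1995, Ch. 3 §3 (3.1), Lemma 3.6]
[cite: Kottwitz1992, §7 p. 393] -/
def blockRescale {c : K} (hc : c ≠ 0) : symplecticGroup l K →* symplecticGroup l K :=
  MonoidHom.mk' (fun g => ⟨_, coe_coe_conj_scalarBlockGSp_mem_symplecticGroup hc g⟩) fun g h =>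
    ofSymplectic_injective (by
      have key : ∀ x : symplecticGroup l K,
          ofSymplectic (⟨_, coe_coe_conj_scalarBlockGSp_mem_symplecticGroup hc x⟩ : symplecticGroup l K) =
            scalarBlockGSp c hc * ofSymplectic x * (scalarBlockGSp c hc)⁻¹ := fun x => Subtype.ext (Units.ext rfl)
      rw [key, map_mul, map_mul, key, key]
      group)

/-- `ι(ρ_c g) = diag(c·1; 1) ι(g) diag(c·1; 1)⁻¹` in `GSp(J, K)`. [cite: AndrianovZhuravlev1995, Ch. 3 §3 Lemma 3.6] -/
theorem ofSymplectic_blockRescale {c : K} (hc : c ≠ 0) (g : symplecticGroup l K) :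
    ofSymplectic (blockRescale hc g) = scalarBlockGSp c hc * ofSymplectic g * (scalarBlockGSp c hc)⁻¹ :=
  Subtype.ext (Units.ext rfl)

/-- The entries of `ρ_c g`: `(ρ_c g)_{s s'} = d_s g_{s s'} d'_{s'}` with `d = (c·1; 1)`, `d' = (c⁻¹·1; 1)`.
[cite: AndrianovZhuravlev1995, Ch. 3 §3 Lemma 3.6] -/
theorem coe_blockRescale_apply {c : K} (hc : c ≠ 0) (g : symplecticGroup l K) (s s' : l ⊕ l) :
    (blockRescale hc g : Matrix (l ⊕ l) (l ⊕ l) K) s s' =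
      Sum.elim (fun _ : l => c) (fun _ : l => (1 : K)) s * (g : Matrix (l ⊕ l) (l ⊕ l) K) s s' *
        Sum.elim (fun _ : l => c⁻¹) (fun _ : l => (1 : K)) s' := by
  change (((scalarBlockGSp c hc * ofSymplectic g * (scalarBlockGSp c hc)⁻¹ : symplecticSimilitudeGroup l K) :
    GL (l ⊕ l) K) : Matrix (l ⊕ l) (l ⊕ l) K) s s' = _
  rw [scalarBlockGSp_inv, Subgroup.coe_mul, Subgroup.coe_mul, Units.val_mul, Units.val_mul, coe_coe_scalarBlockGSp,
    coe_coe_scalarBlockGSp, coe_ofSymplectic, Matrix.mul_diagonal, Matrix.diagonal_mul]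

/-- `(ρ_c g)_{inl i, inl j} = g_{inl i, inl j}`. [cite: AndrianovZhuravlev1995, Ch. 3 §3 Lemma 3.6] -/
theorem coe_blockRescale_apply_inl_inl {c : K} (hc : c ≠ 0) (g : symplecticGroup l K) (i j : l) :
    (blockRescale hc g : Matrix (l ⊕ l) (l ⊕ l) K) (Sum.inl i) (Sum.inl j) =
      (g : Matrix (l ⊕ l) (l ⊕ l) K) (Sum.inl i) (Sum.inl j) := by
  rw [coe_blockRescale_apply, Sum.elim_inl, Sum.elim_inl, mul_right_comm, mul_inv_cancel₀ hc, one_mul]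

/-- `(ρ_c g)_{inl i, inr j} = c g_{inl i, inr j}`. [cite: AndrianovZhuravlev1995, Ch. 3 §3 Lemma 3.6] -/
theorem coe_blockRescale_apply_inl_inr {c : K} (hc : c ≠ 0) (g : symplecticGroup l K) (i j : l) :
    (blockRescale hc g : Matrix (l ⊕ l) (l ⊕ l) K) (Sum.inl i) (Sum.inr j) =
      c * (g : Matrix (l ⊕ l) (l ⊕ l) K) (Sum.inl i) (Sum.inr j) := by
  rw [coe_blockRescale_apply, Sum.elim_inl, Sum.elim_inr, mul_one]

/-- `(ρ_c g)_{inr i, inl j} = c⁻¹ g_{inr i, inl j}`. [cite: AndrianovZhuravlev1995, Ch. 3 §3 Lemma 3.6] -/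
theorem coe_blockRescale_apply_inr_inl {c : K} (hc : c ≠ 0) (g : symplecticGroup l K) (i j : l) :
    (blockRescale hc g : Matrix (l ⊕ l) (l ⊕ l) K) (Sum.inr i) (Sum.inl j) =
      c⁻¹ * (g : Matrix (l ⊕ l) (l ⊕ l) K) (Sum.inr i) (Sum.inl j) := by
  rw [coe_blockRescale_apply, Sum.elim_inr, Sum.elim_inl, one_mul, mul_comm]

/-- `(ρ_c g)_{inr i, inr j} = g_{inr i, inr j}`. [cite: AndrianovZhuravlev1995, Ch. 3 §3 Lemma 3.6] -/
theorem coe_blockRescale_apply_inr_inr {c : K} (hc : c ≠ 0) (g : symplecticGroup l K) (i j : l) :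
    (blockRescale hc g : Matrix (l ⊕ l) (l ⊕ l) K) (Sum.inr i) (Sum.inr j) =
      (g : Matrix (l ⊕ l) (l ⊕ l) K) (Sum.inr i) (Sum.inr j) := by
  rw [coe_blockRescale_apply, Sum.elim_inr, Sum.elim_inr, one_mul, mul_one]

/-- `ρ_c` preserves the diagonal entries. [cite: AndrianovZhuravlev1995, Ch. 3 §3 Lemma 3.6] -/
theorem coe_blockRescale_apply_self {c : K} (hc : c ≠ 0) (g : symplecticGroup l K) (s : l ⊕ l) :
    (blockRescale hc g : Matrix (l ⊕ l) (l ⊕ l) K) s s = (g : Matrix (l ⊕ l) (l ⊕ l) K) s s := by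
  rcases s with i | i
  · exact coe_blockRescale_apply_inl_inl hc g i i
  · exact coe_blockRescale_apply_inr_inr hc g i i

/-- `ρ_c` fixes the diagonal torus. [cite: AndrianovZhuravlev1995, Ch. 3 §3 Lemma 3.6] -/
theorem blockRescale_of_coe_eq_diagonal {c : K} (hc : c ≠ 0) {t : symplecticGroup l K} {d : l ⊕ l → K}
    (ht : (t : Matrix (l ⊕ l) (l ⊕ l) K) = Matrix.diagonal d) : blockRescale hc t = t := by
  refine Subtype.ext (Matrix.ext fun s s' => ?_)
  by_cases hss' : s = s'
  · subst hss'
    exact coe_blockRescale_apply_self hc t s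
  · rw [coe_blockRescale_apply, ht, Matrix.diagonal_apply_ne _ hss', mul_zero, zero_mul]

end Rescale

/-! ## §2 `ρ_c` on the root groups of `U`: `ρ_c(u(S(C))) = u(S(c⁻¹C))`, `ρ_c(m(1 + N_k(c'))) = m(1 + N_k(c'))` -/

section RootGroups

variable {n : ℕ}

/-- `ρ_c(u(S(C))) = u(S(c⁻¹C))`: the Siegel lower radical is rescaled by `c⁻¹`. [cite: AndrianovZhuravlev1995, Ch. 3 §3 Lemma 3.4, Lemma 3.6] -/
theorem blockRescale_siegelLowerHom {c : K} (hc : c ≠ 0) (C : Multiplicative (Fin n × Fin n → K)) :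
    blockRescale hc (siegelLowerHom n K C) =
      siegelLowerHom n K (Multiplicative.ofAdd fun p => c⁻¹ * Multiplicative.toAdd C p) := by
  refine Subtype.ext (Matrix.ext fun s s' => ?_)
  rcases s with a | a <;> rcases s' with b | b
  · rw [coe_blockRescale_apply_inl_inl, coe_siegelLowerHom, coe_siegelLowerHom, Matrix.fromBlocks_apply₁₁,
      Matrix.fromBlocks_apply₁₁]
  · rw [coe_blockRescale_apply_inl_inr, coe_siegelLowerHom, coe_siegelLowerHom, Matrix.fromBlocks_apply₁₂,
      Matrix.fromBlocks_apply₁₂, Matrix.zero_apply, mul_zero]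
  · rw [coe_blockRescale_apply_inr_inl, coe_siegelLowerHom, coe_siegelLowerHom, Matrix.fromBlocks_apply₂₁,
      Matrix.fromBlocks_apply₂₁, Matrix.of_apply, Matrix.of_apply, toAdd_ofAdd]
    split_ifs <;> rfl
  · rw [coe_blockRescale_apply_inr_inr, coe_siegelLowerHom, coe_siegelLowerHom, Matrix.fromBlocks_apply₂₂,
      Matrix.fromBlocks_apply₂₂]

/-- `ρ_c(m(1 + N_k(c'))) = m(1 + N_k(c'))`: the Levi subgroup is fixed. [cite: AndrianovZhuravlev1995, Ch. 3 §3 Lemma 3.6] -/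
theorem blockRescale_leviColumnHom {c : K} (hc : c ≠ 0) (k : Fin n) (c' : Multiplicative (Fin n → K)) :
    blockRescale hc (leviColumnHom k c') = leviColumnHom k c' := by
  refine Subtype.ext (Matrix.ext fun s s' => ?_)
  rcases s with a | a <;> rcases s' with b | b
  · rw [coe_blockRescale_apply_inl_inl]
  · rw [coe_blockRescale_apply_inl_inr, (leviColumnHom_apply_inr_inl k c' a b).2, mul_zero]
  · rw [coe_blockRescale_apply_inr_inl, (leviColumnHom_apply_inr_inl k c' a b).1, mul_zero]
  · rw [coe_blockRescale_apply_inr_inr]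

variable [Valued K ℤᵐ⁰] {ϖ : K}

/-- `ρ_c(X_k(ν)) = X_k(ν)`. [cite: AndrianovZhuravlev1995, Ch. 3 §3 Lemma 3.6] [cite: BruhatTits1972, §6.1] -/
theorem map_blockRescale_leviColumnBall {c : K} (hc : c ≠ 0) (k : Fin n) (ν : Fin n → ℤ) :
    (leviColumnBall n K k ν).map (blockRescale hc) = leviColumnBall n K k ν := by
  have h : (blockRescale hc).comp (leviColumnHom (K := K) k) = leviColumnHom k :=
    MonoidHom.ext fun c' => blockRescale_leviColumnHom hc k c'
  rw [leviColumnBall, Subgroup.map_map, h]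

end RootGroups

/-! ## §3 The shifted Siegel balls `N^{(m)}(ν) = {u(C) : v(C_{ab}) ≤ exp(ν_a + ν_b + m)}` -/

section Shift

variable {n : ℕ} [Valued K ℤᵐ⁰] {ϖ : K}

/-- **`N^{(m)}(ν)`** — the Siegel ball of weight `ν` SHIFTED by `m ∈ ℤ`: `{u(C) : ᵗC = C, v(C_{ab}) ≤ exp(ν_a + ν_b + m)}`.
For `m = 0` this is `N(ν)` (`siegelLowerBallShift_zero`); odd shifts are NOT of the form `N(ν')` (the radii `ν'_a + ν'_b` have even
diagonal `2ν'_a`), and they are exactly what conjugation by similitudes of odd multiplier valuation produces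
(`map_blockRescale_siegelLowerBallShift`): the root `-2f_a - (multiplier)` of `GSp_{2n}` pairs to `-2a_a - m` with `(m, a) ∈ X_*(T)`.
[cite: AndrianovZhuravlev1995, Ch. 3 §3 Lemma 3.4, Lemma 3.6] [cite: BruhatTits1972, §6.1] [cite: Macdonald1995, Ch. V (2.6)] -/
def siegelLowerBallShift (n : ℕ) (K : Type*) [Field K] [Valued K ℤᵐ⁰] (ν : Fin n → ℤ) (m : ℤ) :
    Subgroup (symplecticGroup (Fin n) K) :=
  (AddSubgroup.toSubgroup (AddSubgroup.pi Set.univ fun p : Fin n × Fin n =>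
      if p.1 ≤ p.2 then (Valued.v : Valuation K ℤᵐ⁰).leAddSubgroup (WithZero.exp (ν p.1 + ν p.2 + m)) else ⊤)).map
    (siegelLowerHom n K)

/-- `N^{(0)}(ν) = N(ν)`. [cite: AndrianovZhuravlev1995, Ch. 3 §3 Lemma 3.4] -/
theorem siegelLowerBallShift_zero (ν : Fin n → ℤ) : siegelLowerBallShift n K ν 0 = siegelLowerBall n K ν := by
  simp only [siegelLowerBallShift, siegelLowerBall, add_zero]

/-- Membership in `N^{(m)}(ν)`. [cite: AndrianovZhuravlev1995, Ch. 3 §3 Lemma 3.4] -/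
theorem mem_siegelLowerBallShift_iff {ν : Fin n → ℤ} {m : ℤ} {g : symplecticGroup (Fin n) K} :
    g ∈ siegelLowerBallShift n K ν m ↔ ∃ c : Fin n × Fin n → K,
      (∀ a b : Fin n, a ≤ b → Valued.v (c (a, b)) ≤ WithZero.exp (ν a + ν b + m)) ∧
        siegelLowerHom n K (Multiplicative.ofAdd c) = g := by
  rw [siegelLowerBallShift, Subgroup.mem_map]
  constructor
  · rintro ⟨x, hx, rfl⟩
    refine ⟨Multiplicative.toAdd x, fun a b hab => ?_, rfl⟩
    have h := (AddSubgroup.mem_pi _).1 (show Multiplicative.toAdd x ∈ _ from hx) (a, b) (Set.mem_univ _)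
    simp only [if_pos hab] at h
    exact h
  · rintro ⟨c, hc, rfl⟩
    refine ⟨Multiplicative.ofAdd c, ?_, rfl⟩
    change c ∈ AddSubgroup.pi Set.univ _
    refine (AddSubgroup.mem_pi _).2 fun p _ => ?_
    by_cases hp : p.1 ≤ p.2
    · rw [if_pos hp]; exact hc p.1 p.2 hp
    · rw [if_neg hp]; exact AddSubgroup.mem_top _

/-- The generators of `N^{(m)}(ν)`. [cite: AndrianovZhuravlev1995, Ch. 3 §3 Lemma 3.4] -/
theorem siegelLowerHom_mem_siegelLowerBallShift {ν : Fin n → ℤ} {m : ℤ} {c : Fin n × Fin n → K}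
    (hc : ∀ a b : Fin n, a ≤ b → Valued.v (c (a, b)) ≤ WithZero.exp (ν a + ν b + m)) :
    siegelLowerHom n K (Multiplicative.ofAdd c) ∈ siegelLowerBallShift n K ν m :=
  mem_siegelLowerBallShift_iff.2 ⟨c, hc, rfl⟩

/-- `N^{(m)}(ν) ≤ U(K)`. [cite: AndrianovZhuravlev1995, Ch. 1 §3 Prop. 3.7] -/
theorem siegelLowerBallShift_le_symplecticUnipotent (ν : Fin n → ℤ) (m : ℤ) :
    siegelLowerBallShift n K ν m ≤ symplecticUnipotent n K := by
  intro g hg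
  obtain ⟨c, -, rfl⟩ := mem_siegelLowerBallShift_iff.1 hg
  exact siegelLowerHom_mem_symplecticUnipotent _

/-- Monotonicity of `N^{(m)}(ν)` in the radii `ν_a + ν_b + m`. [cite: BruhatTits1972, §6.1] -/
theorem siegelLowerBallShift_mono {ν ν' : Fin n → ℤ} {m m' : ℤ} (h : ∀ a b, a ≤ b → ν a + ν b + m ≤ ν' a + ν' b + m') :
    siegelLowerBallShift n K ν m ≤ siegelLowerBallShift n K ν' m' := by
  intro g hg
  obtain ⟨c, hc, rfl⟩ := mem_siegelLowerBallShift_iff.1 hg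
  exact siegelLowerHom_mem_siegelLowerBallShift fun a b hab => (hc a b hab).trans (WithZero.exp_le_exp.2 (h a b hab))

/-- `N^{(m)}(ν) ≤ B(𝒪)` when all radii `ν_a + ν_b + m ≤ 0`. [cite: AndrianovZhuravlev1995, Ch. 3 §3 Lemma 3.4] -/
theorem siegelLowerBallShift_le_borelInt {ν : Fin n → ℤ} {m : ℤ} (h : ∀ a b, a ≤ b → ν a + ν b + m ≤ 0) :
    siegelLowerBallShift n K ν m ≤ symplecticBorel n K ⊓ symplecticInt (Fin n) K := by
  refine (siegelLowerBallShift_mono (ν' := (0 : Fin n → ℤ)) (m' := 0) fun a b hab => ?_).trans ?_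
  · simpa only [Pi.zero_apply, add_zero] using h a b hab
  · rw [siegelLowerBallShift_zero]
    exact siegelLowerBall_le_borelInt fun _ => le_rfl

/-- **`t_μ N^{(m)}(ν) t_μ⁻¹ = N^{(m)}(ν + μ)`**: conjugation by `t_μ ∈ Sp` shifts the weight, not `m`.
[cite: BruhatTits1972, (4.4.3), §6.1] [cite: Macdonald1995, Ch. V (2.6)] -/
theorem conjAct_smul_siegelLowerBallShift (hϖ : Valued.v ϖ = WithZero.exp (-1 : ℤ)) {t : symplecticGroup (Fin n) K}
    {μ : Fin n → ℤ} (ht : (t : Matrix (Fin n ⊕ Fin n) (Fin n ⊕ Fin n) K) = Matrix.diagonal fun s => ϖ ^ Sum.elim μ (-μ) s)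
    (ν : Fin n → ℤ) (m : ℤ) :
    toConjAct t • siegelLowerBallShift n K ν m = siegelLowerBallShift n K (ν + μ) m := by
  have hϖ0 := uniformizer_ne_zero hϖ
  ext g
  rw [Subgroup.mem_smul_pointwise_iff_exists]
  constructor
  · rintro ⟨s, hs, rfl⟩
    obtain ⟨c, hc, rfl⟩ := mem_siegelLowerBallShift_iff.1 hs
    rw [toConjAct_smul, conj_siegelLowerHom hϖ0 ht]
    refine siegelLowerHom_mem_siegelLowerBallShift fun a b hab => ?_
    show Valued.v (ϖ ^ (-μ a - μ b) * c (a, b)) ≤ _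
    rw [map_mul, v_uniformizer_zpow hϖ, Pi.add_apply, Pi.add_apply,
      show ν a + μ a + (ν b + μ b) + m = -(-μ a - μ b) + (ν a + ν b + m) by ring, WithZero.exp_add]
    exact mul_le_mul_right (hc a b hab) _
  · intro hg
    obtain ⟨c, hc, rfl⟩ := mem_siegelLowerBallShift_iff.1 hg
    refine ⟨siegelLowerHom n K (Multiplicative.ofAdd fun p => ϖ ^ (μ p.1 + μ p.2) * c p),
      siegelLowerHom_mem_siegelLowerBallShift fun a b hab => ?_, ?_⟩
    · show Valued.v (ϖ ^ (μ a + μ b) * c (a, b)) ≤ _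
      rw [map_mul, v_uniformizer_zpow hϖ]
      have h := hc a b hab
      rw [Pi.add_apply, Pi.add_apply] at h
      have h' := mul_le_mul_right h (WithZero.exp (-(μ a + μ b)))
      rwa [← WithZero.exp_add, show -(μ a + μ b) + (ν a + μ a + (ν b + μ b) + m) = ν a + ν b + m by ring] at h'
    · rw [toConjAct_smul, conj_siegelLowerHom hϖ0 ht]
      congr 1
      refine congrArg Multiplicative.ofAdd (funext fun p => ?_)
      rw [toAdd_ofAdd, ← mul_assoc, ← zpow_add₀ hϖ0, show -μ p.1 - μ p.2 + (μ p.1 + μ p.2) = 0 by ring, zpow_zero, one_mul]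

/-- **`ρ_{ϖ^m}(N^{(k)}(ν)) = N^{(k+m)}(ν)`**: the rescaling by `ϖ^m` shifts the Siegel radii by `m` (`u(C) ↦ u(ϖ^{-m}C)`).
[cite: AndrianovZhuravlev1995, Ch. 3 §3 Lemma 3.4, Lemma 3.6] [cite: BruhatTits1972, §6.1] -/
theorem map_blockRescale_siegelLowerBallShift (hϖ : Valued.v ϖ = WithZero.exp (-1 : ℤ)) (ν : Fin n → ℤ) (k m : ℤ) :
    (siegelLowerBallShift n K ν k).map (blockRescale (zpow_ne_zero m (uniformizer_ne_zero hϖ))) =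
      siegelLowerBallShift n K ν (k + m) := by
  have hϖ0 := uniformizer_ne_zero hϖ
  ext g
  rw [Subgroup.mem_map]
  constructor
  · rintro ⟨x, hx, rfl⟩
    obtain ⟨c, hc, rfl⟩ := mem_siegelLowerBallShift_iff.1 hx
    rw [blockRescale_siegelLowerHom]
    refine siegelLowerHom_mem_siegelLowerBallShift fun a b hab => ?_
    show Valued.v ((ϖ ^ m)⁻¹ * c (a, b)) ≤ _
    rw [← _root_.zpow_neg, map_mul, v_uniformizer_zpow hϖ, neg_neg, show ν a + ν b + (k + m) = m + (ν a + ν b + k) by ring,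
      WithZero.exp_add]
    exact mul_le_mul_right (hc a b hab) _
  · intro hg
    obtain ⟨c, hc, rfl⟩ := mem_siegelLowerBallShift_iff.1 hg
    refine ⟨siegelLowerHom n K (Multiplicative.ofAdd fun p => ϖ ^ m * c p),
      siegelLowerHom_mem_siegelLowerBallShift fun a b hab => ?_, ?_⟩
    · show Valued.v (ϖ ^ m * c (a, b)) ≤ _
      rw [map_mul, v_uniformizer_zpow hϖ]
      have h' := mul_le_mul_right (hc a b hab) (WithZero.exp (-m))
      rwa [← WithZero.exp_add, show -m + (ν a + ν b + (k + m)) = ν a + ν b + k by ring] at h'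
    · rw [blockRescale_siegelLowerHom]
      congr 1
      refine congrArg Multiplicative.ofAdd (funext fun p => ?_)
      rw [toAdd_ofAdd, ← mul_assoc, inv_mul_cancel₀ (zpow_ne_zero m hϖ0), one_mul]

end Shift

/-! ## §4 Normalisation, disjointness and index of the shifted Siegel balls -/

section ShiftStructure

variable {n : ℕ}

/-- A subgroup `L` all of whose elements conjugate `H` into itself normalises `H`. [folklore] -/
private theorem le_normalizer_of_conj_le' {G : Type*} [Group G] {L H : Subgroup G} (h : ∀ g ∈ L, toConjAct g • H ≤ H) :
    L ≤ Subgroup.normalizer (H : Set G) := by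
  intro g hg
  rw [Subgroup.mem_normalizer_iff]
  intro x
  constructor
  · intro hx
    have hx' : toConjAct g • x ∈ toConjAct g • H := Subgroup.smul_mem_pointwise_smul _ _ _ hx
    rw [toConjAct_smul] at hx'
    exact h g hg hx'
  · intro hx
    have hx' : toConjAct g⁻¹ • (g * x * g⁻¹) ∈ toConjAct g⁻¹ • H := Subgroup.smul_mem_pointwise_smul _ _ _ hx
    rw [toConjAct_smul, inv_inv, show g⁻¹ * (g * x * g⁻¹) * g = x by group] at hx'
    exact h g⁻¹ (L.inv_mem hg) hx'

variable [Valued K ℤᵐ⁰] {ϖ : K}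

/-- **The Levi columns normalise `N^{(m)}(ν)`**: `X_k(ν) ≤ N_G(N^{(m)}(ν))` — `m(D)u(C)m(D)⁻¹ = u(DCᵗD)` and the radii
`(ν_a - ν_j) + (ν_j + ν_b + m) + (ν_b' - ν_b) …` add up (ultrametric inequality). [cite: BruhatTits1972, §6.1]
[cite: Macdonald1995, Ch. V (2.6)] -/
theorem leviColumnBall_le_normalizer_siegelLowerBallShift (k : Fin n) (ν : Fin n → ℤ) (m : ℤ) :
    leviColumnBall n K k ν ≤ Subgroup.normalizer (siegelLowerBallShift n K ν m : Set (symplecticGroup (Fin n) K)) := by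
  refine le_normalizer_of_conj_le' fun g hg => ?_
  obtain ⟨c', hc', rfl⟩ := mem_leviColumnBall_iff.1 hg
  intro y hy
  rw [Subgroup.mem_smul_pointwise_iff_exists] at hy
  obtain ⟨x, hx, rfl⟩ := hy
  obtain ⟨c, hc, rfl⟩ := mem_siegelLowerBallShift_iff.1 hx
  rw [toConjAct_smul, mul_siegelLowerHom_of_blocks_eq_zero (fun i j => (leviColumnHom_apply_inr_inl k _ i j).2)
    (fun i j => (leviColumnHom_apply_inr_inl k _ i j).1), mul_inv_cancel_right]
  refine siegelLowerHom_mem_siegelLowerBallShift fun a b _ => ?_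
  have hD : ((leviColumnHom k (Multiplicative.ofAdd c') : symplecticGroup (Fin n) K) :
      Matrix (Fin n ⊕ Fin n) (Fin n ⊕ Fin n) K).toBlocks₂₂ = 1 + leviColumnNil k c' := by
    ext i j
    rw [Matrix.toBlocks₂₂, Matrix.of_apply, coe_leviColumnHom, Matrix.fromBlocks_apply₂₂, toAdd_ofAdd]
  dsimp only
  rw [hD]
  have hS : ∀ l' m' : Fin n, Valued.v ((Matrix.of fun a b => if a ≤ b then c (a, b) else c (b, a) : Matrix (Fin n) (Fin n) K) l' m') ≤
      WithZero.exp (ν l' + (ν m' + m)) := by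
    intro l' m'
    rw [Matrix.of_apply, ← add_assoc]
    split_ifs with hlm
    · exact hc l' m' hlm
    · rw [add_comm (ν l')]; exact hc m' l' (le_of_not_ge hlm)
  have h1 : ∀ a m' : Fin n, Valued.v (((1 + leviColumnNil k c') *
      (Matrix.of fun a b => if a ≤ b then c (a, b) else c (b, a) : Matrix (Fin n) (Fin n) K)) a m') ≤
        WithZero.exp ((ν a + m) - (-ν) m') := by
    intro a m'
    rw [Pi.neg_apply, sub_neg_eq_add, show ν a + m + ν m' = ν a + (ν m' + m) by ring]
    exact v_mul_apply_le_exp (f := ν) (g := ν) (h := fun b => ν b + m) (v_one_add_leviColumnNil_apply_le hc') hS a m'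
  rw [show ν a + ν b + m = (ν a + m) + ν b by ring]
  refine v_mul_apply_le_exp (f := fun a => ν a + m) (g := -ν) (h := ν) h1 (fun m' b => ?_) a b
  rw [Matrix.transpose_apply, Pi.neg_apply, show -ν m' + ν b = ν b - ν m' by ring]
  exact v_one_add_leviColumnNil_apply_le hc' b m'

/-- `⨆_j X_j(ν)` normalises `N^{(m)}(ν)`. [cite: BruhatTits1972, §6.1] -/
theorem iSup_leviColumnBall_le_normalizer_siegelLowerBallShift (ν : Fin n → ℤ) (m : ℤ) :
    (⨆ j : Fin n, leviColumnBall n K j ν) ≤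
      Subgroup.normalizer (siegelLowerBallShift n K ν m : Set (symplecticGroup (Fin n) K)) :=
  iSup_le fun j => leviColumnBall_le_normalizer_siegelLowerBallShift j ν m

/-- **`(⨆_j X_j(ν)) ∩ N^{(m)}(ν') = 1`**. [cite: BruhatTits1972, §6.1] [cite: AndrianovZhuravlev1995, Ch. 1 §3 Prop. 3.7] -/
theorem iSup_leviColumnBall_inf_siegelLowerBallShift_eq_bot (ν ν' : Fin n → ℤ) (m : ℤ) :
    (⨆ j : Fin n, leviColumnBall n K j ν) ⊓ siegelLowerBallShift n K ν' m = ⊥ := by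
  rw [eq_bot_iff]
  intro g hg
  obtain ⟨hg₁, hg₂⟩ := Subgroup.mem_inf.1 hg
  obtain ⟨c, -, rfl⟩ := mem_siegelLowerBallShift_iff.1 hg₂
  rw [Subgroup.mem_bot]
  have hg₁' : siegelLowerHom n K (Multiplicative.ofAdd c) ∈ ⨆ (j : Fin n) (_ : (j : ℕ) < n), leviColumnBall n K j ν := by
    simp only [Fin.is_lt, iSup_pos]
    exact hg₁
  refine siegelLowerHom_eq_one_of_forall fun a b hab => ?_
  have h := (apply_of_mem_iSup_leviColumnBall hg₁').1 a b
  rwa [siegelLowerHom_apply_inr_inl hab] at h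

/-- The kernel of the Siegel parametrisation lies in every shifted box. [folklore] -/
private theorem ker_siegelLowerHom_le_shift (ν : Fin n → ℤ) (m : ℤ) :
    (siegelLowerHom n K).ker ≤ AddSubgroup.toSubgroup (AddSubgroup.pi Set.univ fun p : Fin n × Fin n =>
      if p.1 ≤ p.2 then (Valued.v : Valuation K ℤᵐ⁰).leAddSubgroup (WithZero.exp (ν p.1 + ν p.2 + m)) else ⊤) := by
  intro c hc
  rw [MonoidHom.mem_ker] at hc
  change Multiplicative.toAdd c ∈ AddSubgroup.pi Set.univ _
  refine (AddSubgroup.mem_pi _).2 fun p _ => ?_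
  by_cases hp : p.1 ≤ p.2
  · rw [if_pos hp, show p = (p.1, p.2) from rfl, apply_eq_zero_of_siegelLowerHom_eq_one hc hp]
    exact AddSubgroup.zero_mem _
  · rw [if_neg hp]
    exact AddSubgroup.mem_top _

/-- **`[N^{(m')}(ν') : N^{(m)}(ν)] = q^{Σ_{a≤b} ((ν'_a + ν'_b + m') - (ν_a + ν_b + m))⁺}`**. [cite: Macdonald1995, Ch. V (2.6)]
[cite: CartierCorvallis1979, §I.3] [cite: AndrianovZhuravlev1995, Ch. 3 §3 Lemma 3.4] -/
theorem relIndex_siegelLowerBallShift (hϖ : Valued.v ϖ = WithZero.exp (-1 : ℤ)) [Finite 𝓀[K]] (ν ν' : Fin n → ℤ)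
    (m m' : ℤ) :
    (siegelLowerBallShift n K ν m).relIndex (siegelLowerBallShift n K ν' m') =
      Nat.card 𝓀[K] ^ ∑ p ∈ Finset.univ.filter (fun p : Fin n × Fin n => p.1 ≤ p.2),
        ((ν' p.1 + ν' p.2 + m') - (ν p.1 + ν p.2 + m)).toNat := by
  rw [siegelLowerBallShift, siegelLowerBallShift, Subgroup.relIndex_map_map, sup_eq_left.2 (ker_siegelLowerHom_le_shift ν m),
    sup_eq_left.2 (ker_siegelLowerHom_le_shift ν' m'), AddSubgroup.relIndex_toSubgroup, relIndex_pi_univ]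
  have h : ∀ p : Fin n × Fin n,
      (if p.1 ≤ p.2 then (Valued.v : Valuation K ℤᵐ⁰).leAddSubgroup (WithZero.exp (ν p.1 + ν p.2 + m)) else ⊤ :
          AddSubgroup K).relIndex
          (if p.1 ≤ p.2 then (Valued.v : Valuation K ℤᵐ⁰).leAddSubgroup (WithZero.exp (ν' p.1 + ν' p.2 + m')) else ⊤) =
        if p.1 ≤ p.2 then Nat.card 𝓀[K] ^ ((ν' p.1 + ν' p.2 + m') - (ν p.1 + ν p.2 + m)).toNat else 1 := by
    intro p
    split_ifs with hp
    · exact relIndex_leAddSubgroup_exp hϖ _ _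
    · exact AddSubgroup.relIndex_top_left _
  rw [Finset.prod_congr rfl fun p _ => h p, ← Finset.prod_filter, Finset.prod_pow_eq_pow_sum]

end ShiftStructure

/-! ## §5 The dévissage with a shifted Siegel part: `[U(0) : N^{(m)}(a) ⊔ ⨆_k X_k(a)]` -/

section Devissage

variable {n : ℕ} [Valued K ℤᵐ⁰] {ϖ : K}

/-- `(Q ⊔ N) ⊓ N' = N` when `N ≤ N'`, `Q` normalises `N` and `Q ∩ N' = 1`. [folklore] -/
private theorem sup_inf_eq_right_of_disjoint' {G : Type*} [Group G] {Q N N' : Subgroup G} (hNN' : N ≤ N')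
    (hQn : Q ≤ Subgroup.normalizer (N : Set G)) (hdisj : Q ⊓ N' = ⊥) : (Q ⊔ N) ⊓ N' = N := by
  refine le_antisymm (fun x hx => ?_) (le_inf le_sup_right hNN')
  obtain ⟨hxQN, hxN'⟩ := Subgroup.mem_inf.1 hx
  have hx' : x ∈ ((Q ⊔ N : Subgroup G) : Set G) := hxQN
  rw [Subgroup.coe_mul_of_left_le_normalizer_right Q N hQn] at hx'
  obtain ⟨y, hy, z, hz, rfl⟩ := Set.mem_mul.1 hx'
  have hyN' : y ∈ N' := by
    have e : y = y * z * z⁻¹ := by rw [mul_inv_cancel_right]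
    rw [e]
    exact N'.mul_mem hxN' (N'.inv_mem (hNN' hz))
  have hy1 : y = 1 := by
    rw [← Subgroup.mem_bot, ← hdisj]
    exact Subgroup.mem_inf.2 ⟨hy, hyN'⟩
  rw [hy1, one_mul]
  exact hz

/-- **`[U(0) : N^{(m)}(a) ⊔ ⨆_k X_k(a)] = q^{Σ_j Σ_{i<j} (a_j - a_i) + Σ_{i≤j} (-a_i - a_j - m)}`** for `a` monotone with
`a_i + a_j + m ≤ 0` (`i ≤ j`): the Levi chain of `SymplecticBorelModulusIndex` followed by the Siegel step with the SHIFTED ball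
`N^{(m)}(a) ≤ N(0)`. [cite: Macdonald1995, Ch. V (2.6), (2.9)] [cite: Laumon1995, (4.1.4)] [cite: CartierCorvallis1979, §I.3] -/
theorem relIndex_unipotentBallShift_eq_pow (hϖ : Valued.v ϖ = WithZero.exp (-1 : ℤ)) [Finite 𝓀[K]] {a : Fin n → ℤ} {m : ℤ}
    (ha : Monotone a) (ham : ∀ i j, i ≤ j → a i + a j + m ≤ 0) :
    (siegelLowerBallShift n K a m ⊔ ⨆ k : Fin n, leviColumnBall n K k a).relIndex
        (siegelLowerBall n K (0 : Fin n → ℤ) ⊔ ⨆ k : Fin n, leviColumnBall n K k (0 : Fin n → ℤ)) =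
      Nat.card 𝓀[K] ^ ((∑ j : Fin n, ∑ i ∈ Finset.Iio j, (a j - a i).toNat) +
        ∑ p ∈ Finset.univ.filter (fun p : Fin n × Fin n => p.1 ≤ p.2), (-a p.1 - a p.2 - m).toNat) := by
  have hfull : ∀ ν : Fin n → ℤ, (⨆ j : Fin n, leviColumnBall n K j ν) =
      ⨆ (j : Fin n) (_ : (j : ℕ) < n), leviColumnBall n K j ν := fun ν => by
    simp only [Fin.is_lt, iSup_pos]
  have hQmono : (⨆ j : Fin n, leviColumnBall n K j a) ≤ ⨆ j : Fin n, leviColumnBall n K j (0 : Fin n → ℤ) :=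
    iSup_mono fun j => leviColumnBall_le_leviColumnBall_zero ha j
  have hNmono : siegelLowerBallShift n K a m ≤ siegelLowerBallShift n K (0 : Fin n → ℤ) 0 :=
    siegelLowerBallShift_mono fun i j hij => by simpa only [Pi.zero_apply, add_zero] using ham i j hij
  have hQ'n := iSup_leviColumnBall_le_normalizer_siegelLowerBallShift (K := K) (0 : Fin n → ℤ) 0
  have hQn := iSup_leviColumnBall_le_normalizer_siegelLowerBallShift (K := K) a m
  rw [← siegelLowerBallShift_zero, sup_comm (siegelLowerBallShift n K a m), sup_comm (siegelLowerBallShift n K (0 : Fin n → ℤ) 0),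
    relIndex_eq_mul_relIndex_of_devissage (sup_le_sup hQmono hNmono) le_sup_right le_sup_left
      (Subgroup.coe_mul_of_left_le_normalizer_right _ _ hQ'n).subset (sup_le hQ'n Subgroup.le_normalizer)
      (Subgroup.coe_mul_of_left_le_normalizer_right _ _ hQn).subset le_sup_left
      (sup_inf_eq_right_of_disjoint' hNmono hQn (iSup_leviColumnBall_inf_siegelLowerBallShift_eq_bot a 0 0)) hQmono
      (iSup_leviColumnBall_inf_siegelLowerBallShift_eq_bot 0 0 0),
    hfull, hfull, relIndex_biSup_leviColumnBall_eq_pow hϖ ha n le_rfl, relIndex_siegelLowerBallShift hϖ a 0 m 0, ← pow_add]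
  congr 1
  simp only [Fin.is_lt, if_true, Pi.zero_apply, add_zero, zero_sub, neg_add']

end Devissage

/-! ## §6 The twisted modulus index `[B(𝒪) : B(𝒪) ∩ ρ_{ϖ^m}(t_aB(𝒪)t_a⁻¹)]` -/

section Twisted

variable {n : ℕ} [Valued K ℤᵐ⁰] {ϖ : K}

/-- **Twisted torus removal** `B(𝒪) ⊆ U(𝒪) · ρ_c(t_aB(𝒪)t_a⁻¹)`: `g = (gd⁻¹)·d` with `d` the diagonal of `g`, and
`d = ρ_c(t_a d t_a⁻¹) ∈ ρ_c(t_aB(𝒪)t_a⁻¹)`. [cite: CartierCorvallis1979, §I.3, §IV (4.2)] [cite: Laumon1995, (4.1.4)] -/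
theorem borelInt_subset_unipotentInt_mul_map_blockRescale {c : K} (hc : c ≠ 0) {t : symplecticGroup (Fin n) K}
    {μ : Fin n → ℤ} (ht : (t : Matrix (Fin n ⊕ Fin n) (Fin n ⊕ Fin n) K) = Matrix.diagonal fun s => ϖ ^ Sum.elim μ (-μ) s) :
    ((symplecticBorel n K ⊓ symplecticInt (Fin n) K : Subgroup (symplecticGroup (Fin n) K)) : Set (symplecticGroup (Fin n) K)) ⊆
      ((symplecticUnipotent n K ⊓ symplecticInt (Fin n) K : Subgroup (symplecticGroup (Fin n) K)) : Set (symplecticGroup (Fin n) K)) *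
        (((toConjAct t • (symplecticBorel n K ⊓ symplecticInt (Fin n) K)).map (blockRescale hc) :
            Subgroup (symplecticGroup (Fin n) K)) : Set (symplecticGroup (Fin n) K)) := by
  intro g hg
  obtain ⟨hgB, hgK⟩ := Subgroup.mem_inf.1 hg
  have hdiag : ∀ i, (g : Matrix (Fin n ⊕ Fin n) (Fin n ⊕ Fin n) K) (Sum.inl i) (Sum.inl i) *
      (g : Matrix (Fin n ⊕ Fin n) (Fin n ⊕ Fin n) K) (Sum.inr i) (Sum.inr i) = 1 := fun i => by
    rw [mul_comm]; exact apply_inr_mul_apply_inl_eq_one hgB i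
  set d' : symplecticGroup (Fin n) K :=
    ⟨Matrix.diagonal fun s => (g : Matrix (Fin n ⊕ Fin n) (Fin n ⊕ Fin n) K) s s,
      diagonal_mem_symplecticGroup (d := fun s => (g : Matrix (Fin n ⊕ Fin n) (Fin n ⊕ Fin n) K) s s) hdiag⟩ with hd'
  have hdcoe : (d' : Matrix (Fin n ⊕ Fin n) (Fin n ⊕ Fin n) K) =
      Matrix.diagonal fun s => (g : Matrix (Fin n ⊕ Fin n) (Fin n ⊕ Fin n) K) s s := rfl
  have hdB : d' ∈ symplecticBorel n K := mem_symplecticBorel_of_coe_eq_diagonal hdcoe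
  have hdK : d' ∈ symplecticInt (Fin n) K := mem_symplecticInt_iff.2 fun s s' => by
    rw [hdcoe, Matrix.diagonal_apply]
    split_ifs
    · exact hgK s s
    · rw [map_zero]; exact zero_le
  have hcomm : d' * t = t * d' := by
    refine Subtype.ext ?_
    rw [Submonoid.coe_mul, Submonoid.coe_mul, hdcoe, ht, Matrix.diagonal_mul_diagonal, Matrix.diagonal_mul_diagonal]
    congr 1
    funext s
    exact mul_comm _ _
  have hdt : d' ∈ toConjAct t • (symplecticBorel n K ⊓ symplecticInt (Fin n) K) := by
    rw [Subgroup.mem_pointwise_smul_iff_inv_smul_mem, ← toConjAct_inv, toConjAct_smul, inv_inv, mul_assoc, hcomm,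
      inv_mul_cancel_left]
    exact Subgroup.mem_inf.2 ⟨hdB, hdK⟩
  have hdH : d' ∈ (toConjAct t • (symplecticBorel n K ⊓ symplecticInt (Fin n) K)).map (blockRescale hc) :=
    Subgroup.mem_map.2 ⟨d', hdt, blockRescale_of_coe_eq_diagonal hc hdcoe⟩
  have huB : g * d'⁻¹ ∈ symplecticBorel n K := (symplecticBorel n K).mul_mem hgB ((symplecticBorel n K).inv_mem hdB)
  have hu' : g * d'⁻¹ ∈ symplecticUnipotent n K ⊓ symplecticInt (Fin n) K := by
    refine Subgroup.mem_inf.2 ⟨⟨huB, fun i => ?_⟩, (symplecticInt (Fin n) K).mul_mem hgK ((symplecticInt (Fin n) K).inv_mem hdK)⟩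
    have h := blockTriangular_mul_apply_self (K := K) symplecticBorelOrder_injective huB hdB (Sum.inr i)
    rw [← Submonoid.coe_mul, inv_mul_cancel_right, hdcoe, Matrix.diagonal_apply_eq] at h
    have hne := apply_inr_ne_zero hgB i
    have h' : (1 : K) * (g : Matrix (Fin n ⊕ Fin n) (Fin n ⊕ Fin n) K) (Sum.inr i) (Sum.inr i) =
        ((g * d'⁻¹ : symplecticGroup (Fin n) K) : Matrix (Fin n ⊕ Fin n) (Fin n ⊕ Fin n) K) (Sum.inr i) (Sum.inr i) *
          (g : Matrix (Fin n ⊕ Fin n) (Fin n ⊕ Fin n) K) (Sum.inr i) (Sum.inr i) := by rw [one_mul]; exact h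
    exact (mul_right_cancel₀ hne h').symm
  exact Set.mem_mul.2 ⟨g * d'⁻¹, hu', d', hdH, by rw [inv_mul_cancel_right]⟩

/-- **`U(𝒪) ∩ ρ_c(t_aB(𝒪)t_a⁻¹) = U(𝒪) ∩ ρ_c(t_aU(𝒪)t_a⁻¹)`**: `ρ_c ∘ Int(t_a)` preserves the diagonal entries.
[cite: CartierCorvallis1979, §IV (4.2)] -/
theorem unipotentInt_inf_map_blockRescale_conjAct_borelInt_eq (hϖ : Valued.v ϖ = WithZero.exp (-1 : ℤ)) {c : K} (hc : c ≠ 0)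
    {t : symplecticGroup (Fin n) K} {μ : Fin n → ℤ}
    (ht : (t : Matrix (Fin n ⊕ Fin n) (Fin n ⊕ Fin n) K) = Matrix.diagonal fun s => ϖ ^ Sum.elim μ (-μ) s) :
    (symplecticUnipotent n K ⊓ symplecticInt (Fin n) K) ⊓
        (toConjAct t • (symplecticBorel n K ⊓ symplecticInt (Fin n) K)).map (blockRescale hc) =
      (symplecticUnipotent n K ⊓ symplecticInt (Fin n) K) ⊓
        (toConjAct t • (symplecticUnipotent n K ⊓ symplecticInt (Fin n) K)).map (blockRescale hc) := by
  refine le_antisymm (fun g hg => ?_) (inf_le_inf_left _ (Subgroup.map_mono (Subgroup.pointwise_smul_le_pointwise_smul_iff.2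
    (inf_le_inf_right _ symplecticUnipotent_le_symplecticBorel))))
  obtain ⟨hgU, hgH⟩ := Subgroup.mem_inf.1 hg
  obtain ⟨x, hx, hxg⟩ := Subgroup.mem_map.1 hgH
  refine Subgroup.mem_inf.2 ⟨hgU, Subgroup.mem_map.2 ⟨x, ?_, hxg⟩⟩
  rw [Subgroup.mem_pointwise_smul_iff_inv_smul_mem, ← toConjAct_inv, toConjAct_smul] at hx ⊢
  obtain ⟨hB, hK⟩ := Subgroup.mem_inf.1 hx
  refine Subgroup.mem_inf.2 ⟨⟨hB, fun i => ?_⟩, hK⟩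
  rw [coe_conj_apply_of_coe_eq_diagonal_zpow (uniformizer_ne_zero hϖ) (coe_inv_eq_diagonal_zpow_neg hϖ ht), sub_self,
    zpow_zero, one_mul, ← coe_blockRescale_apply_self hc x (Sum.inr i), hxg]
  exact (Subgroup.mem_inf.1 hgU).1.2 i

/-- **`ρ_{ϖ^m}(t_aU(𝒪)t_a⁻¹) = N^{(m)}(a) ⊔ ⨆_k X_k(a)`**. [cite: AndrianovZhuravlev1995, Ch. 3 §3 Lemma 3.4, Lemma 3.6]
[cite: BruhatTits1972, (4.4.3), §6.1] -/
theorem map_blockRescale_conjAct_unipotentInt_eq (hϖ : Valued.v ϖ = WithZero.exp (-1 : ℤ)) {t : symplecticGroup (Fin n) K}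
    {a : Fin n → ℤ} (ht : (t : Matrix (Fin n ⊕ Fin n) (Fin n ⊕ Fin n) K) = Matrix.diagonal fun s => ϖ ^ Sum.elim a (-a) s)
    (m : ℤ) :
    (toConjAct t • (symplecticUnipotent n K ⊓ symplecticInt (Fin n) K)).map
        (blockRescale (zpow_ne_zero m (uniformizer_ne_zero hϖ))) =
      siegelLowerBallShift n K a m ⊔ ⨆ k : Fin n, leviColumnBall n K k a := by
  rw [conjAct_smul_unipotentInt_eq hϖ ht, Subgroup.map_sup, Subgroup.map_iSup, ← siegelLowerBallShift_zero,
    map_blockRescale_siegelLowerBallShift hϖ, zero_add]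
  simp only [map_blockRescale_leviColumnBall]

/-- **THE TWISTED MODULUS INDEX (sum form)**: for `a ∈ ℤⁿ` monotone with `a_i + a_j + m ≤ 0` (`i ≤ j`),
`[B(𝒪) : B(𝒪) ∩ ρ_{ϖ^m}(t_aB(𝒪)t_a⁻¹)] = q^{Σ_j Σ_{i<j} (a_j - a_i) + Σ_{i≤j} (-a_i - a_j - m)}` — the index of the conjugate of
`B(𝒪) ≤ Sp_{2n}` by the SIMILITUDE `diag(ϖ^m ϖ^a; ϖ^{-a})`, computed inside `Sp_{2n}(K)`. [cite: Macdonald1995, Ch. V (2.6), (2.9)]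
[cite: CartierCorvallis1979, §I.3, §IV (4.2)] [cite: AndrianovZhuravlev1995, Ch. 3 §3 Lemma 3.6] [cite: Laumon1995, (4.1.4)] -/
theorem relIndex_map_blockRescale_conjAct_borelInt_eq_pow_sum (hϖ : Valued.v ϖ = WithZero.exp (-1 : ℤ)) [Finite 𝓀[K]]
    {t : symplecticGroup (Fin n) K} {a : Fin n → ℤ}
    (ht : (t : Matrix (Fin n ⊕ Fin n) (Fin n ⊕ Fin n) K) = Matrix.diagonal fun s => ϖ ^ Sum.elim a (-a) s) {m : ℤ}
    (ha : Monotone a) (ham : ∀ i j, i ≤ j → a i + a j + m ≤ 0) :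
    ((toConjAct t • (symplecticBorel n K ⊓ symplecticInt (Fin n) K)).map
          (blockRescale (zpow_ne_zero m (uniformizer_ne_zero hϖ)))).relIndex (symplecticBorel n K ⊓ symplecticInt (Fin n) K) =
      Nat.card 𝓀[K] ^ ((∑ j : Fin n, ∑ i ∈ Finset.Iio j, (a j - a i).toNat) +
        ∑ p ∈ Finset.univ.filter (fun p : Fin n × Fin n => p.1 ≤ p.2), (-a p.1 - a p.2 - m).toNat) := by
  have hUB : symplecticUnipotent n K ⊓ symplecticInt (Fin n) K ≤ symplecticBorel n K ⊓ symplecticInt (Fin n) K :=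
    inf_le_inf_right _ symplecticUnipotent_le_symplecticBorel
  rw [relIndex_eq_relIndex_of_coe_subset_mul hUB (borelInt_subset_unipotentInt_mul_map_blockRescale _ ht),
    ← Subgroup.inf_relIndex_left, unipotentInt_inf_map_blockRescale_conjAct_borelInt_eq hϖ _ ht, Subgroup.inf_relIndex_left,
    map_blockRescale_conjAct_unipotentInt_eq hϖ ht m, unipotentInt_eq_sup]
  exact relIndex_unipotentBallShift_eq_pow hϖ ha ham

/-- `Σ_{i≤j} m = ⟨ρ, m·1⟩` (`= m · n(n+1)/2`: the number of roots in the Siegel radical). [cite: CartierCorvallis1979, §IV (4.2)] -/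
theorem sum_filter_le_const_eq_symplecticRhoPairing (m : ℤ) :
    ∑ p ∈ Finset.univ.filter (fun p : Fin n × Fin n => p.1 ≤ p.2), (fun _ => m) p = symplecticRhoPairing (fun _ : Fin n => m) := by
  rw [Finset.sum_filter, ← Finset.univ_product_univ, Finset.sum_product, symplecticRhoPairing]
  refine Finset.sum_congr rfl fun i _ => ?_
  rw [← Finset.sum_filter, Finset.sum_const, show Finset.univ.filter (fun j : Fin n => i ≤ j) = Finset.Ici i by ext j; simp,
    Fin.card_Ici, nsmul_eq_mul]
  have hni : ((n - (i : ℕ) : ℕ) : ℤ) = (n : ℤ) - (i : ℕ) := by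
    have := i.is_lt
    omega
  rw [hni]

/-- **The twisted root sum**: `Σ_j Σ_{i<j} (a_j - a_i) + Σ_{i≤j} (-a_i - a_j - m) = -2⟨ρ, a⟩ - ⟨ρ, m·1⟩`.
[cite: CartierCorvallis1979, §IV (4.2)] [cite: Macdonald1995, Ch. V (2.6), (2.9)] -/
theorem sum_sub_add_sum_neg_sub_eq (a : Fin n → ℤ) (m : ℤ) :
    (∑ j : Fin n, ∑ i ∈ Finset.Iio j, (a j - a i)) +
        ∑ p ∈ Finset.univ.filter (fun p : Fin n × Fin n => p.1 ≤ p.2), (-a p.1 - a p.2 - m) =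
      -(2 * symplecticRhoPairing a) - symplecticRhoPairing (fun _ : Fin n => m) := by
  rw [← sum_sub_add_sum_neg_eq_neg_two_mul_symplecticRhoPairing a, ← sum_filter_le_const_eq_symplecticRhoPairing m, add_sub_assoc,
    ← Finset.sum_sub_distrib]

/-- For `a` monotone with `a_i + a_j + m ≤ 0` the `ℕ`-valued exponent is `(-2⟨ρ, a⟩ - ⟨ρ, m·1⟩)⁺`. [cite: CartierCorvallis1979, §IV (4.2)] -/
theorem sum_toNat_add_sum_toNat_sub_eq (a : Fin n → ℤ) (m : ℤ) (ha : Monotone a) (ham : ∀ i j, i ≤ j → a i + a j + m ≤ 0) :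
    (∑ j : Fin n, ∑ i ∈ Finset.Iio j, (a j - a i).toNat) +
        ∑ p ∈ Finset.univ.filter (fun p : Fin n × Fin n => p.1 ≤ p.2), (-a p.1 - a p.2 - m).toNat =
      (-(2 * symplecticRhoPairing a) - symplecticRhoPairing (fun _ : Fin n => m)).toNat := by
  have hE : (((∑ j : Fin n, ∑ i ∈ Finset.Iio j, (a j - a i).toNat) +
      ∑ p ∈ Finset.univ.filter (fun p : Fin n × Fin n => p.1 ≤ p.2), (-a p.1 - a p.2 - m).toNat : ℕ) : ℤ) =
        -(2 * symplecticRhoPairing a) - symplecticRhoPairing (fun _ : Fin n => m) := by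
    rw [← sum_sub_add_sum_neg_sub_eq a m]
    push_cast
    congr 1
    · refine Finset.sum_congr rfl fun j _ => Finset.sum_congr rfl fun i hi => ?_
      exact Int.toNat_of_nonneg (sub_nonneg.2 (ha (Finset.mem_Iio.1 hi).le))
    · refine Finset.sum_congr rfl fun p hp => ?_
      exact Int.toNat_of_nonneg (by linarith [ham p.1 p.2 (Finset.mem_filter.1 hp).2])
  omega

/-- **THE TWISTED MODULUS INDEX**: `[B(𝒪) : B(𝒪) ∩ ρ_{ϖ^m}(t_aB(𝒪)t_a⁻¹)] = q^{-2⟨ρ, a⟩ - ⟨ρ, m·1⟩}` for `a ∈ ℤⁿ` monotone with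
`a_i + a_j + m ≤ 0` (`i ≤ j`) — the modulus of the similitude `diag(ϖ^m ϖ^a; ϖ^{-a})` on the Borel of `GSp_{2n}`, computed in
`Sp_{2n}`; for `m = 0` this is `SymplecticBorelModulusIndex.relIndex_conjAct_borelInt_eq_pow`. [cite: Macdonald1995, Ch. V (2.6), (2.9)]
[cite: CartierCorvallis1979, §I.3, §IV (4.2)] [cite: AndrianovZhuravlev1995, Ch. 3 §3 Lemma 3.6, §3.3 Thm. 3.30] -/
theorem relIndex_map_blockRescale_conjAct_borelInt_eq_pow (hϖ : Valued.v ϖ = WithZero.exp (-1 : ℤ)) [Finite 𝓀[K]]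
    {t : symplecticGroup (Fin n) K} {a : Fin n → ℤ}
    (ht : (t : Matrix (Fin n ⊕ Fin n) (Fin n ⊕ Fin n) K) = Matrix.diagonal fun s => ϖ ^ Sum.elim a (-a) s) {m : ℤ}
    (ha : Monotone a) (ham : ∀ i j, i ≤ j → a i + a j + m ≤ 0) :
    ((toConjAct t • (symplecticBorel n K ⊓ symplecticInt (Fin n) K)).map
          (blockRescale (zpow_ne_zero m (uniformizer_ne_zero hϖ)))).relIndex (symplecticBorel n K ⊓ symplecticInt (Fin n) K) =
      Nat.card 𝓀[K] ^ (-(2 * symplecticRhoPairing a) - symplecticRhoPairing (fun _ : Fin n => m)).toNat := by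
  rw [relIndex_map_blockRescale_conjAct_borelInt_eq_pow_sum hϖ ht ha ham, sum_toNat_add_sum_toNat_sub_eq a m ha ham]

end Twisted

end Literature.NumberTheory.Automorphic.SymplecticCartan

end
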